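import Literature.AlgebraicGeometry.ShimuraVarieties.UnitaryCurveSiegelBorel
import Literature.AlgebraicGeometry.Morphisms.ClopenPieceOfCoproduct
import Literature.AlgebraicGeometry.Motives.UniversalHypersurfaceQuasiProjective
import Literature.AlgebraicGeometry.Motives.AlgPointsSeparate
import Literature.AlgebraicGeometry.HodgeTheory.QuasiProjectiveSeparatedOfField
import HarnessLib

/-!
# The slice morphism of a disc-quotient piece FACTORS through the piece of the target chart system (E6-fac)

Topic `AlgebraicGeometry/ShimuraVarieties`; namespaces `Literature.AlgebraicGeometry.ShimuraVarieties.UnitaryBallUniformisationDatum`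
(§1, any rank `p`, dotted on the datum) and `Literature.AlgebraicGeometry.ShimuraVarieties.UnitaryCanonicalModel` (§2–§3, the
record-curve piece form of ★ `UnitaryCurveSiegelBorel` §1).  THEOREMS ONLY (no definition, no named fact, no instance, no `sorry`).

## The mathematics

★ `UnitaryBallUniformisationDatum.exists_hom_of_holomorphicSiegelLift_chart'` (Borel's extension theorem in the compact case, from
GAGA) produces, from a compact ball quotient `X = Γ\𝔹` with uniformisation `unif_X`, a smooth quasi-projective target `V` with ONE
chart `ιc : Sc ⟶ V`, `unif : 𝔥_g → Sc(ℂ)` (continuous, holomorphic in affine algebraic coordinates) and a point map `f : X(ℂ) → V(ℂ)`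
with a holomorphic Siegel lift `f (unif_X v) = ιc (unif (Z v))`, a morphism `ψ : X ⟶ V` with `ψ(P) = f(P)` on complex points.

When the charts `(ιc_c : Sc_c ⟶ V)_c` form a COPRODUCT decomposition of `V` (the (U1) clause of ★ `siegelModuli_complexUniformisation`:
`IsColimit (Cofan.mk V ιc)`; e.g. the connected components `Γ_c\𝔥_g` of `𝓐_{g,δ,N} ⊗ ℂ`), each leg `ιc_c` is an OPEN IMMERSION
(★ `Morphisms.isOpenImmersion_of_isColimit_cofan`), so the piece `Sc_c` is itself smooth and quasi-projective over `ℂ`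
(★ `IsQuasiProjectiveOver.of_isOpenImmersion`) and `ιc_c` is injective on complex points.  Applying the ★ chart theorem to the
TARGET `Sc_c` (with the identity chart) and to the point map `f′ := ιc_c⁻¹ ∘ f` (well defined on `unif_X(cone) = X(ℂ)`, ★ field
`surjOn_unif`) gives the FACTORISATION

* §1 **`exists_hom_factor_of_holomorphicSiegelLift_chart'`** (any rank, one open-immersed chart): `∃ ψ : X ⟶ Sc`,
  `ψ (unif_X v) = unif (Z v)` on the cone AND `ιc (ψ P) = f P` for every complex point `P`;
* §2 **`RecordSystem`-piece form `exists_hom_piece_factor_of_holomorphicSiegelLift`** (rank `1`, cone rewritten along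
  `B.Hℂ = J⋆^τ`, legs of a colimit cofan, tokens of ★ `exists_hom_piece_of_holomorphicSiegelLift`): `∃ ψ_q : X ⟶ Sc c`,
  `ψ_q (B.unif v) = unif c (Z v)` for `v` in the negative cone of `J⋆^τ`, and `ιc c (ψ_q P) = Φ (ι P)` for all `P`;
* §3 **`piece_factor_comp_eq_of_forall_map_eq`** — the factorisation is COMPATIBLE with any global slice morphism `ψ : X ⟶ V`
  having the same point formula: `ψ_q ≫ ιc c = ψ` (complex points separate morphisms out of the reduced finite-type `X` into the
  separated `V`, ★ `SchemeOver.hom_ext_of_forall_algPoints`).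

This is the per-piece factorisation `ψ_q : X_q ⟶ S_{c(q)}` of the complex slice morphism `Sh_K(U(J⋆), 𝔻)_ℂ ⟶ 𝓐_{g,δ,N} ⊗ ℂ`
through the connected component of the Siegel moduli space met by the piece ([Deligne1971TravauxShimura] 4.11–4.12;
[Milne2005ShimuraVarieties] Lemma 5.13, Thm. 5.16), consumed by the E6 closer of cell `hodgecm-mathlib` (P6 door (E), road map
E6 v2 §0 step 2).  HC_CM is proved only modulo the 2 remaining named inputs (hLiu418, h413) until rung 0 closes; count-neutral.

## References
* [Borel1972ExtensionTheorem] A. Borel, J. Differential Geom. 6 (1972), Thm. 3.10 p. 559.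
* [Milne2005ShimuraVarieties] J. S. Milne, *Introduction to Shimura varieties*, Thm. 3.14, Lemma 5.13 p. 57, Thm. 5.16.
* [Deligne1971TravauxShimura] P. Deligne, *Travaux de Shimura*, Sém. Bourbaki 389 (1971), 4.11–4.12 p. 148.
* [GortzWedhorn2020] U. Görtz, T. Wedhorn, *Algebraic Geometry I* (2nd ed. 2020), §(3.5) Example 3.11 (p. 73).
* [MumfordAV1970] D. Mumford, *Abelian Varieties* (1970), §4 (points separate morphisms of varieties).
-/

set_option autoImplicit false

noncomputable section

open Function Topology NumberField CategoryTheory CategoryTheory.Limits Matrix AlgebraicGeometry Set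
open scoped Matrix ComplexOrder
open Literature.AlgebraicGeometry.Motives Literature.AlgebraicGeometry.Motives.AlgPoints
open Literature.AlgebraicGeometry.HodgeTheory (IsQuasiProjectiveOver)
open Literature.NumberTheory.Automorphic (siegelUpperHalfSpace)

namespace Literature.AlgebraicGeometry.ShimuraVarieties

/-! ### §1. Any rank: factorisation through one open-immersed chart -/

namespace UnitaryBallUniformisationDatum

variable {p : ℕ} {X : SchemeOver ℂ} (D : UnitaryBallUniformisationDatum p X) {g : ℕ}

omit D in
/-- An open immersion of `ℂ`-schemes is injective on complex points (it is a monomorphism; points are morphisms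
`Spec ℂ ⟶ ·` over `ℂ`). [cite: GortzWedhorn2020, §(3.5) Example 3.11 (p. 73)] -/
theorem map_injective_of_isOpenImmersion {Sc V : SchemeOver ℂ} (ιc : Sc ⟶ V) [IsOpenImmersion ιc.left] :
    Function.Injective (AlgPoints.map (L := ℂ) ιc) := by
  intro Q Q' h
  ext : 1
  rw [← cancel_mono ιc.left]
  exact congrArg (fun P : ComplexPoints V => P.left) h

/-- **Borel's extension theorem on one compact ball-quotient piece — FACTORISATION THROUGH AN OPEN-IMMERSED CHART.**
For a smooth quasi-projective `V` over `ℂ`, an OPEN IMMERSION `ιc : Sc ⟶ V` with a uniformisation `unif : 𝔥_g → Sc(ℂ)`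
(continuous on `𝔥_g`, holomorphic in affine algebraic coordinates), a point map `f : X(ℂ) → V(ℂ)` and an entrywise holomorphic,
`𝔥_g`-valued `Z` on the cone with `f (unif_X v) = ιc (unif (Z v))`: there is `ψ : X ⟶ Sc` INTO THE CHART with
`ψ (unif_X v) = unif (Z v)` on the cone and `ιc (ψ P) = f P` for every complex point `P` of `X`.  (The chart `Sc` is smooth —
open immersion followed by `V → Spec ℂ` — and quasi-projective, ★ `IsQuasiProjectiveOver.of_isOpenImmersion`; apply ★
`exists_hom_of_holomorphicSiegelLift_chart'` to the target `Sc` with the identity chart and the point map `ιc⁻¹ ∘ f`, well defined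
because `ιc` is injective on points and `unif_X` maps the cone ONTO `X(ℂ)`, field `surjOn_unif`.)
[cite: Borel1972ExtensionTheorem, Thm. 3.10 p. 559] [cite: Milne2005ShimuraVarieties, Thm. 3.14, Lemma 5.13 p. 57 and Thm. 5.16] -/
theorem exists_hom_factor_of_holomorphicSiegelLift_chart' (V : SchemeOver ℂ) [Smooth V.hom]
    (hV : IsQuasiProjectiveOver V) {Sc : SchemeOver ℂ} (ιc : Sc ⟶ V) [IsOpenImmersion ιc.left]
    (unif : Matrix (Fin g) (Fin g) ℂ → ComplexPoints Sc) (hcont : ContinuousOn unif (siegelUpperHalfSpace g))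
    (hhol : ∀ (U : Sc.left.affineOpens) (s : Sc.left.presheaf.obj (Opposite.op (↑U : Sc.left.Opens))),
      DifferentiableOn ℂ (fun Z ↦ evalOrZero (↑U : Sc.left.Opens) s (unif Z))
        (siegelUpperHalfSpace g ∩ unif ⁻¹' {P | P.pt ∈ (↑U : Sc.left.Opens)}))
    (f : ComplexPoints X → ComplexPoints V) (Z : (Fin (p + 1) → ℂ) → Matrix (Fin g) (Fin g) ℂ)
    (hZ : ∀ i j, DifferentiableOn ℂ (fun v => Z v i j) D.cone)
    (hZmem : ∀ v ∈ D.cone, Z v ∈ siegelUpperHalfSpace g)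
    (hf : ∀ v ∈ D.cone, f (D.unif v) = AlgPoints.map ιc (unif (Z v))) :
    ∃ ψ : X ⟶ Sc, (∀ v ∈ D.cone, AlgPoints.map ψ (D.unif v) = unif (Z v)) ∧
      ∀ P : ComplexPoints X, AlgPoints.map ιc (AlgPoints.map ψ P) = f P := by
  classical
  -- the chart is smooth and quasi-projective over `ℂ`, and injective on complex points
  haveI : Smooth Sc.hom := by
    rw [← Over.w ιc]
    infer_instance
  have hSc : IsQuasiProjectiveOver Sc := IsQuasiProjectiveOver.of_isOpenImmersion ιc hV
  have hinj : Function.Injective (AlgPoints.map (L := ℂ) ιc) := map_injective_of_isOpenImmersion ιc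
  -- the point map into the chart: `f′ := ιc⁻¹ ∘ f` where defined, junk elsewhere
  obtain ⟨f', hf'def⟩ : ∃ f' : ComplexPoints X → ComplexPoints Sc,
      f' = fun P => if h : ∃ R, AlgPoints.map ιc R = f P then h.choose else unif (Z 0) := ⟨_, rfl⟩
  have hf' : ∀ v ∈ D.cone, f' (D.unif v) = unif (Z v) := by
    intro v hv
    have h : ∃ R, AlgPoints.map ιc R = f (D.unif v) := ⟨unif (Z v), (hf v hv).symm⟩
    have h1 : f' (D.unif v) = h.choose := by
      rw [hf'def]
      exact dif_pos h
    rw [h1]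
    exact hinj (h.choose_spec.trans (hf v hv))
  -- Borel on the piece, with target the chart itself and the identity chart
  obtain ⟨ψ, hψ⟩ := D.exists_hom_of_holomorphicSiegelLift_chart' Sc hSc (𝟙 Sc) unif hcont hhol f' Z hZ hZmem
    (fun v hv => by rw [hf' v hv, AlgPoints.map_id_apply])
  refine ⟨ψ, fun v hv => (hψ _).trans (hf' v hv), fun P => ?_⟩
  -- every complex point of `X` is uniformised (field `surjOn_unif`)
  obtain ⟨v, hv, hvP⟩ := D.surjOn_unif (Set.mem_univ P)
  rw [← hvP, hψ, hf' v hv, ← hf v hv]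

end UnitaryBallUniformisationDatum

/-! ### §2. The record-curve piece form (rank `1`, legs of a colimit cofan, cone of `J⋆^τ`) -/

namespace UnitaryCanonicalModel

variable {L : Type} [Field L] [NumberField L] [IsCMField L] {Jstar : Matrix (Fin 2) (Fin 2) L} {τ : L →+* ℂ}

section Piece

variable {g : ℕ} {κ : Type} (V : SchemeOver ℂ) [Smooth V.hom] (hV : IsQuasiProjectiveOver V)
  (Sc : κ → SchemeOver ℂ) (ιc : ∀ c, Sc c ⟶ V) (hcol : IsColimit (Cofan.mk V ιc))
  (unif : ∀ c : κ, Matrix (Fin g) (Fin g) ℂ → ComplexPoints (Sc c))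
  (unif_cont : ∀ c, ContinuousOn (unif c) (siegelUpperHalfSpace g))
  (unif_hol : ∀ (c : κ) (U : (Sc c).left.affineOpens) (s : (Sc c).left.presheaf.obj (Opposite.op (↑U : (Sc c).left.Opens))),
    DifferentiableOn ℂ (fun Z ↦ AlgPoints.evalOrZero (↑U : (Sc c).left.Opens) s (unif c Z))
      (siegelUpperHalfSpace g ∩ unif c ⁻¹' {P | P.pt ∈ (↑U : (Sc c).left.Opens)}))

omit [NumberField L] [IsCMField L] in
include hV hcol unif_cont unif_hol in
/-- **E6-fac — the per-piece FACTORISATION of the slice morphism through the piece of the chart system.**  Let the charts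
`(ιc_c : Sc_c ⟶ V)_c` be the legs of a COLIMIT COFAN of the smooth quasi-projective `V` (the (U1) decomposition of
`𝓐_{g,δ,N} ⊗ ℂ`), `(X, B)` a compact disc quotient with `B.Hℂ = J⋆^τ`, `ι : X ⟶ Y`, `Φ : Y(ℂ) → V(ℂ)`, and `c`, `Z` with
`Φ (ι (B.unif v)) = ιc_c (unif_c (Z v))` on the negative cone (`Z` entrywise holomorphic and `𝔥_g`-valued there).  Then there is
`ψ_q : X ⟶ Sc c` with `ψ_q (B.unif v) = unif_c (Z v)` on the negative cone of `J⋆^τ` AND `ιc_c (ψ_q P) = Φ (ι P)` for every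
complex point `P` of `X` (legs of a colimit cofan are open immersions, ★ `Morphisms.isOpenImmersion_of_isColimit_cofan`; then
§1). [cite: Deligne1971TravauxShimura, 4.11–4.12 p. 148] [cite: Milne2005ShimuraVarieties, Lemma 5.13 p. 57 and Thm. 5.16]
[cite: Borel1972ExtensionTheorem, Thm. 3.10 p. 559] -/
theorem exists_hom_piece_factor_of_holomorphicSiegelLift {X Y : SchemeOver ℂ} (B : UnitaryBallUniformisationDatum 1 X)
    (hB : B.Hℂ = Jstar.map τ) (ι : X ⟶ Y) (Φ : ComplexPoints Y → ComplexPoints V) (c : κ)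
    (Z : (Fin 2 → ℂ) → Matrix (Fin g) (Fin g) ℂ)
    (Z_hol : ∀ i j, DifferentiableOn ℂ (fun v => Z v i j) (negCone (Jstar.map τ)))
    (Z_mem : ∀ v, v ∈ negCone (Jstar.map τ) → Z v ∈ siegelUpperHalfSpace g)
    (hΦ : ∀ (v : Fin 2 → ℂ), v ∈ negCone (Jstar.map τ) →
      Φ (AlgPoints.map ι (B.unif v)) = AlgPoints.map (ιc c) (unif c (Z v))) :
    ∃ ψq : X ⟶ Sc c, (∀ v, v ∈ negCone (Jstar.map τ) → AlgPoints.map ψq (B.unif v) = unif c (Z v)) ∧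
      ∀ P : ComplexPoints X, AlgPoints.map (ιc c) (AlgPoints.map ψq P) = Φ (AlgPoints.map ι P) := by
  obtain ⟨hc'⟩ := Literature.AlgebraicGeometry.Morphisms.isColimit_cofan_left hcol
  haveI : IsOpenImmersion (ιc c).left := Literature.AlgebraicGeometry.Morphisms.isOpenImmersion_of_isColimit_cofan hc' c
  have hcone : B.cone = negCone (Jstar.map τ) := by
    change negCone B.Hℂ = negCone (Jstar.map τ)
    rw [hB]
  obtain ⟨ψ, h1, h2⟩ := B.exists_hom_factor_of_holomorphicSiegelLift_chart' V hV (ιc c) (unif c) (unif_cont c)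
    (unif_hol c) (Φ ∘ AlgPoints.map ι) Z (fun i j => by rw [hcone]; exact Z_hol i j)
    (fun v hv => by rw [hcone] at hv; exact Z_mem v hv) (fun v hv => by rw [hcone] at hv; exact hΦ v hv)
  exact ⟨ψ, fun v hv => h1 v (by rw [hcone]; exact hv), fun P => h2 P⟩

omit [NumberField L] [IsCMField L] [Smooth V.hom] in
include hV in
/-- **The factorisation is compatible with the global slice morphism.**  If `ψ : X ⟶ V` has the point formula
`ψ P = Φ (ι P)` (e.g. the restriction to the piece of the glued slice morphism of ★ `RecordSystemGS.exists_hom_of_holomorphicSiegelLifts`)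
and `ψ_q : X ⟶ Sc c` has `ιc_c (ψ_q P) = Φ (ι P)`, then `ψ_q ≫ ιc_c = ψ`: `X` is reduced of finite type (smooth projective, field
`isSmoothProjective`), `V` is separated (quasi-projective), and complex points separate such morphisms (★
`SchemeOver.hom_ext_of_forall_algPoints`). [cite: MumfordAV1970, §4] [cite: Milne2005ShimuraVarieties, Lemma 5.13 p. 57] -/
theorem piece_factor_comp_eq_of_forall_map_eq {X Y : SchemeOver ℂ} (B : UnitaryBallUniformisationDatum 1 X)
    (ι : X ⟶ Y) (Φ : ComplexPoints Y → ComplexPoints V) (c : κ) (ψq : X ⟶ Sc c) (ψ : X ⟶ V)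
    (hψq : ∀ P : ComplexPoints X, AlgPoints.map (ιc c) (AlgPoints.map ψq P) = Φ (AlgPoints.map ι P))
    (hψ : ∀ P : ComplexPoints X, AlgPoints.map ψ P = Φ (AlgPoints.map ι P)) :
    ψq ≫ ιc c = ψ := by
  have hX : IsSmoothProjective 1 X := B.isSmoothProjective
  haveI : SmoothOfRelativeDimension 1 X.hom := hX.smoothOfRelativeDimension
  haveI : Smooth X.hom := SmoothOfRelativeDimension.smooth 1 X.hom
  haveI : LocallyOfFiniteType X.hom := inferInstance
  haveI : IsIntegral X.left := IsSmoothProjective.isIntegral_holds hX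
  haveI : IsSeparated V.hom := hV.hom_isSeparated
  refine SchemeOver.hom_ext_of_forall_algPoints ℂ fun P => ?_
  change AlgPoints.map (ψq ≫ ιc c) P = AlgPoints.map ψ P
  rw [AlgPoints.map_comp_apply, hψq, hψ]

end Piece

end UnitaryCanonicalModel

end Literature.AlgebraicGeometry.ShimuraVarieties

end
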